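import Summits.QuantumFields.YangMills.Theorems.EquipartitionCriticalityCriticalContinuumLimitStubAdmissibleGivesGap
import Summits.Ventures.YMGap.Thresholds.MassGapAtMassive
import Summits.Ventures.YMGap.RobustBall.WilsonOneStateConfinement
import Literature.MathematicalPhysics.QuantumFieldTheory.Balaban1983to89.InfiniteVolumeSufficient
import Literature.MathematicalPhysics.QuantumLattice.RepLieAlgebraUnitary
import HarnessLib

/-!
# Robust ball (Y2) — THE INFINITE-VOLUME TRANSFER-MATRIX (SPECTRAL) GAP OF STRONG-COUPLING LATTICE YANG–MILLS

HONEST FRAMING: venture file of the cell `pub-ymgap` (QuantumFields programme), track ROBUST-BALL, seat rb-p2 (g12).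
LATTICE statements at STRONG COUPLING: the Osterwalder–Schrader reconstruction of the infinite-volume `SU(N)` lattice
Yang–Mills state on `ℤ⁴` (bond time reflection `Θ = gaugeTimeReflect`, unit time shift `τ = gaugeTimeShift`,
positive-time σ-algebra `𝓔₊ = posTimeEvents`; tree `GaugeOSData`, `OSReconstruction`) and the SPECTRAL GAP
`‖T|_{Ω^⊥}‖ ≤ e^{-m}` of its transfer operator `T = e^{-H}` (tree currency `HasInfiniteVolumeGap`).  Nothing about the
continuum limit, the `β → ∞` behaviour of `m`, or the Clay problem; `m` below is the (existential) Shen–Zhu–Zhu /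
Dobrushin clustering rate of the cell's `MassGapAt`, a strong-coupling artefact.

WHAT IS NEW.  The cell's mass-gap theorems are EUCLIDEAN (clustering of truncated correlations of local observables
under the DLR states).  This file gives the HAMILTONIAN statement: a Hilbert space `ℋ`, a vacuum `Ω` and a positive
self-adjoint contraction `T` (the transfer matrix of the infinite lattice) with `spec T ⊆ {1} ∪ [0, e^{-m}]`, `1`
simple.  Inputs (tree theorems): `AdmissibleGap.isOSReconstructible_of_oddTorusLimit` and `dense_osMap_span`
(YangMills summit: odd-torus limit states of a compact second-countable group are OS-reconstructible; the OS images of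
the continuous gauge-invariant positive-time local observables are dense), `cylinderApprox/Ext_of_secondCountable`,
`gapNorm_le_exp_of_dense_clustering` (Glimm–Jaffe 6.1.3 (iii) in dense form), and the identification of the matrix
element `⟪ι A, Tᵗ ι B⟫ − ⟪ι A, Ω⟫⟪Ω, ι B⟫` with `cov_μ(A ∘ Θ, B ∘ τᵗ)` (`clustering_osMatrix_of_local`), which the
cell bounds: `MassGapAt 4 N β` upgrades to all bounded measurable local observables at the same rate by DLR
smoothing (`MassGapMassive.covariance_decay_of_lipschitzClustering`).
RESULTS: `hasMassGap_of_localClustering` / `hasInfiniteVolumeGap_of_localClustering` (every compact second-countable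
`G`, `β ≥ 0`); ★★ `exists_hasInfiniteVolumeGap_of_massGapAt` (every `SU(N)`: `MassGapAt 4 N β`, `β ≥ 0` ⇒
`∃ m > 0, HasInfiniteVolumeGap (fundamentalLatticeRep N) (N β) m`; non-vacuity
`oddTorusLimitPoints_eq_singleton_of_massGapAt`); ★★★ `su2_exists_hasInfiniteVolumeGap` (`SU(2)`, `d = 4`,
HYPOTHESIS-FREE, every `0 < β_W ≤ 9/25`); `hasTimeClustering_of_massGapAt` (Euclidean reading for ALL bounded
positive-time observables, local or not).  0 sorry, 0 definitions.  References: K. Osterwalder, E. Seiler, Ann.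
Phys. 110 (1978) 440, §2; E. Seiler, LNP 159 (1982) Ch. 2; J. Glimm, A. Jaffe, *Quantum Physics* (1987) §6.1
Thm. 6.1.3, §19.7.  Everything here is proved. [folklore]
-/

noncomputable section

open scoped BigOperators Topology ENNReal InnerProductSpace ComplexConjugate
open MeasureTheory Filter ProbabilityTheory
open Literature.MathematicalPhysics.QuantumFieldTheory Literature.MathematicalPhysics.QuantumLattice
open Literature.Probability.LatticeModels (IsOSReconstructible IsBoundedMeasurable positiveEvents TransferData
  osForm)
open Summit.QuantumFields.YangMills.Theorems.ClusteringToYangMills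
open Summit.QuantumFields.YangMills.Theorems.ClusteringToYangMills.Reconstructible
open Summit.QuantumFields.YangMills.Theorems.CriticalContinuumLimit

namespace Summit.Ventures.YMGap.RobustBall.TransferGap

section Helpers

variable {G : Type} [Group G]

omit [Group G] in
/-- The `t`-fold unit time shift is the translation by `-t e₀`: `τ^[t] = configShift (-t e₀)`. [folklore] -/
theorem iterate_gaugeTimeShift_eq [MeasurableSpace G] (t : ℕ) (U : LGConfig 4 G) :
    gaugeTimeShift^[t] U = configShift (-(Pi.single (0 : Fin 4) (t : ℤ))) U := by
  induction t generalizing U with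
  | zero =>
    funext e
    simp [configShift_apply]
  | succ t ih =>
    rw [Function.iterate_succ_apply, ih]
    funext e
    simp only [configShift_apply, gaugeTimeShift_apply, sub_neg_eq_add, Nat.cast_succ, Pi.single_add,
      add_assoc]

/-- A continuous positive-time species is a bounded `𝓔₊`-measurable observable. [folklore] -/
theorem isBoundedMeasurable_posTimeEvents_of_mem [MeasurableSpace G] [TopologicalSpace G] {F : LGConfig 4 G → ℂ}
    (hF : F ∈ contPosTimeObs G) : IsBoundedMeasurable (posTimeEvents G) F := by
  classical
  obtain ⟨A, -, hsupp, rfl⟩ := hF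
  obtain ⟨C, hC⟩ := A.bounded
  refine ⟨Complex.measurable_ofReal.comp ?_, C, fun U => by
    rw [Complex.norm_real, Real.norm_eq_abs]; exact hC U⟩
  have hpad : Measurable[posTimeEvents G] (fun (U : LGConfig 4 G) e => if e ∈ A.supp then U e else (1 : G)) := by
    refine @measurable_pi_lambda _ _ _ (posTimeEvents G) _ _ fun e => ?_
    by_cases he : e ∈ A.supp
    · simp only [he, if_true]
      exact measurable_cylinderEvent_apply (hsupp (Finset.mem_coe.2 he))
    · simp only [he, if_false]
      exact measurable_const
  have hfac : A.F = A.F ∘ fun (U : LGConfig 4 G) e => if e ∈ A.supp then U e else 1 :=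
    funext fun U => A.isCylinder fun e he => by simp only [if_pos (Finset.mem_coe.1 he)]
  rw [hfac]
  exact A.measurable.comp hpad

end Helpers

/-! ### From clustering of local observables to clustering of the OS matrix elements -/

section Clustering

variable {G : Type} [Group G] [TopologicalSpace G] [IsTopologicalGroup G] [CompactSpace G] [MeasurableSpace G]
  [BorelSpace G]

omit [CompactSpace G] in
/-- **The OS matrix elements of two continuous positive-time species are truncated correlations of two bounded
measurable LOCAL observables at time separation `t`**, hence cluster at the rate of the state: if under `μ` (an
OS-reconstructible probability measure for `(Θ, τ, 𝓔₊)`) every pair of bounded measurable local real observables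
`F₁, F₂` has `|cov_μ(F₁, F₂ ∘ θ_x)| ≤ C e^{-m‖x‖_∞}`, then for `A, B ∈ contPosTimeObs G`,
`‖⟪ι A, Tᵗ ι B⟫ − ⟪ι A, Ω⟫⟪Ω, ι B⟫‖ ≤ C e^{-mt}` with `C = C(A ∘ Θ, B)` (Glimm–Jaffe (6.1.12d):
`⟪ι A, Tᵗ ι B⟫ = ∫ Ā∘Θ · B∘τᵗ dμ`, `τᵗ = θ_{-te₀}`, `∫ B∘τᵗ = ∫ B` by shift symmetry). [folklore] -/
theorem clustering_osMatrix_of_local {μ : Measure (LGConfig 4 G)} [IsProbabilityMeasure μ] {m : ℝ}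
    (hcl : ∀ F₁ F₂ : LGConfig 4 G → ℝ, Literature.MathematicalPhysics.QuantumLattice.IsLocalObservable F₁ →
      Literature.MathematicalPhysics.QuantumLattice.IsLocalObservable F₂ → Measurable F₁ → Measurable F₂ →
      (∃ C, ∀ U, |F₁ U| ≤ C) → (∃ C, ∀ U, |F₂ U| ≤ C) →
        ∃ C : ℝ, ∀ x : Literature.Probability.LatticeModels.Site 4,
          |cov[F₁, fun U => F₂ (configShift x U); μ]| ≤ C * Real.exp (-m * ‖x‖))
    (h : IsOSReconstructible μ gaugeTimeReflect gaugeTimeShift (posTimeEvents G))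
    {A B : LGConfig 4 G → ℂ} (hA : A ∈ contPosTimeObs G) (hB : B ∈ contPosTimeObs G) :
    ∃ C : ℝ, ∀ t : ℕ,
      ‖⟪h.osMap A, (h.transferData.T ^ t) (h.osMap B)⟫_ℂ -
          ⟪h.osMap A, h.transferData.vacuum⟫_ℂ * ⟪h.transferData.vacuum, h.osMap B⟫_ℂ‖ ≤
        C * Real.exp (-m * t) := by
  have hAbm := isBoundedMeasurable_posTimeEvents_of_mem hA
  have hBbm := isBoundedMeasurable_posTimeEvents_of_mem hB
  obtain ⟨A₀, hAc, -, rfl⟩ := hA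
  obtain ⟨B₀, hBc, -, rfl⟩ := hB
  obtain ⟨CA, hCA⟩ := A₀.bounded
  obtain ⟨CB, hCB⟩ := B₀.bounded
  -- the two bounded measurable local observables `A₀ ∘ Θ` and `B₀`
  have hloc₁ : Literature.MathematicalPhysics.QuantumLattice.IsLocalObservable (A₀.F ∘ gaugeTimeReflect) := ⟨_, isCylinder_comp_gaugeTimeReflect A₀.isCylinder⟩
  have hloc₂ : Literature.MathematicalPhysics.QuantumLattice.IsLocalObservable B₀.F := ⟨_, B₀.isCylinder⟩
  have hm₁ : Measurable (A₀.F ∘ gaugeTimeReflect) := A₀.measurable.comp measurable_gaugeTimeReflect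
  obtain ⟨C, hC⟩ := hcl (A₀.F ∘ gaugeTimeReflect) B₀.F hloc₁ hloc₂ hm₁ B₀.measurable ⟨CA, fun U => hCA _⟩ ⟨CB, hCB⟩
  -- `∫ B₀ ∘ τᵗ dμ = ∫ B₀ dμ` (shift symmetry of the OS form against the constant `1`)
  have hshift : ∀ t : ℕ, ∫ U, (B₀.F (gaugeTimeShift^[t] U) : ℂ) ∂μ = ∫ U, (B₀.F U : ℂ) ∂μ := by
    intro t
    induction t with
    | zero => rfl
    | succ t ih =>
      have hGt : IsBoundedMeasurable (posTimeEvents G) (fun U => (B₀.F (gaugeTimeShift^[t] U) : ℂ)) :=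
        h.isOSRealisation.isBoundedMeasurable_comp_iterate hBbm t
      have key := h.shift_symm 1 _ (Literature.Probability.LatticeModels.isBoundedMeasurable_one _) hGt
      simp only [osForm, Function.comp_apply, Pi.one_apply, map_one, one_mul] at key
      rw [← ih]
      simpa only [Function.iterate_succ_apply] using key
  refine ⟨C, fun t => ?_⟩
  have hOS := h.isOSRealisation
  rw [← hOS.integral_conj_comp_reflect_mul_comp_iterate hAbm hBbm t, ← hOS.integral_conj_comp_reflect hAbm,
    ← hOS.integral_eq_inner_vacuum hBbm, ← hshift t]
  simp only [Complex.conj_ofReal, ← Complex.ofReal_mul, integral_complex_ofReal, ← Complex.ofReal_sub,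
    Complex.norm_real, Real.norm_eq_abs, iterate_gaugeTimeShift_eq]
  -- the covariance at `x = -t e₀`
  have key := hC (-(Pi.single (0 : Fin 4) (t : ℤ)))
  have hX : MemLp (A₀.F ∘ gaugeTimeReflect) 2 μ :=
    MemLp.of_bound hm₁.aestronglyMeasurable CA (ae_of_all _ fun U => by
      rw [Real.norm_eq_abs]; exact hCA _)
  have hY : MemLp (fun U => B₀.F (configShift (-(Pi.single (0 : Fin 4) (t : ℤ))) U)) 2 μ :=
    MemLp.of_bound (B₀.measurable.comp (configShift _).measurable).aestronglyMeasurable CB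
      (ae_of_all _ fun U => by rw [Real.norm_eq_abs]; exact hCB _)
  rw [covariance_eq_sub hX hY] at key
  have hnorm : ‖(-(Pi.single (0 : Fin 4) (t : ℤ)) : Literature.Probability.LatticeModels.Site 4)‖ = t := by
    rw [norm_neg, Pi.norm_single, Int.norm_natCast]
  rw [hnorm] at key
  simpa only [Pi.mul_apply, Function.comp_apply] using key

/-- Sesquilinear extension of the clustering bound from the pairs of a set `M` to the pairs of its span. [folklore] -/
theorem clustering_span_of_pairs {H : Type*} [NormedAddCommGroup H] [InnerProductSpace ℂ H] [CompleteSpace H]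
    (D : TransferData H) (m : ℝ) {M : Set H}
    (hM : ∀ u ∈ M, ∀ v ∈ M, ∃ C : ℝ, ∀ t : ℕ,
      ‖⟪u, (D.T ^ t) v⟫_ℂ - ⟪u, D.vacuum⟫_ℂ * ⟪D.vacuum, v⟫_ℂ‖ ≤ C * Real.exp (-m * t))
    {u v : H} (hu : u ∈ Submodule.span ℂ M) (hv : v ∈ Submodule.span ℂ M) :
    ∃ C : ℝ, ∀ t : ℕ, ‖⟪u, (D.T ^ t) v⟫_ℂ - ⟪u, D.vacuum⟫_ℂ * ⟪D.vacuum, v⟫_ℂ‖ ≤ C * Real.exp (-m * t) := by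
  -- adapted from the (private) `clustering_span` of
  -- Summits/QuantumFields/YangMills/Theorems/FradkinShenkerFlowClusteringToYangMillsStubGapFromClustering.lean
  refine Submodule.span_induction₂ (p := fun u v _ _ => ∃ C : ℝ, ∀ t : ℕ,
      ‖⟪u, (D.T ^ t) v⟫_ℂ - ⟪u, D.vacuum⟫_ℂ * ⟪D.vacuum, v⟫_ℂ‖ ≤ C * Real.exp (-m * t))
    (fun x y hx hy => hM x hx y hy) (fun y _ => ⟨0, fun t => by simp⟩)
    (fun x _ => ⟨0, fun t => by simp⟩) ?_ ?_ ?_ ?_ hu hv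
  · rintro x y z - - - ⟨C₁, hC₁⟩ ⟨C₂, hC₂⟩
    refine ⟨C₁ + C₂, fun t => ?_⟩
    have e : ⟪x + y, (D.T ^ t) z⟫_ℂ - ⟪x + y, D.vacuum⟫_ℂ * ⟪D.vacuum, z⟫_ℂ =
        (⟪x, (D.T ^ t) z⟫_ℂ - ⟪x, D.vacuum⟫_ℂ * ⟪D.vacuum, z⟫_ℂ) +
          (⟪y, (D.T ^ t) z⟫_ℂ - ⟪y, D.vacuum⟫_ℂ * ⟪D.vacuum, z⟫_ℂ) := by
      rw [inner_add_left, inner_add_left]; ring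
    rw [e, add_mul]
    exact (norm_add_le _ _).trans (add_le_add (hC₁ t) (hC₂ t))
  · rintro x y z - - - ⟨C₁, hC₁⟩ ⟨C₂, hC₂⟩
    refine ⟨C₁ + C₂, fun t => ?_⟩
    have e : ⟪x, (D.T ^ t) (y + z)⟫_ℂ - ⟪x, D.vacuum⟫_ℂ * ⟪D.vacuum, y + z⟫_ℂ =
        (⟪x, (D.T ^ t) y⟫_ℂ - ⟪x, D.vacuum⟫_ℂ * ⟪D.vacuum, y⟫_ℂ) +
          (⟪x, (D.T ^ t) z⟫_ℂ - ⟪x, D.vacuum⟫_ℂ * ⟪D.vacuum, z⟫_ℂ) := by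
      rw [map_add, inner_add_right, inner_add_right]; ring
    rw [e, add_mul]
    exact (norm_add_le _ _).trans (add_le_add (hC₁ t) (hC₂ t))
  · rintro a x y - - ⟨C, hC⟩
    refine ⟨‖a‖ * C, fun t => ?_⟩
    have e : ⟪a • x, (D.T ^ t) y⟫_ℂ - ⟪a • x, D.vacuum⟫_ℂ * ⟪D.vacuum, y⟫_ℂ =
        conj a * (⟪x, (D.T ^ t) y⟫_ℂ - ⟪x, D.vacuum⟫_ℂ * ⟪D.vacuum, y⟫_ℂ) := by
      rw [inner_smul_left, inner_smul_left]; ring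
    rw [e, norm_mul, Complex.norm_conj, mul_assoc]
    exact mul_le_mul_of_nonneg_left (hC t) (norm_nonneg a)
  · rintro a x y - - ⟨C, hC⟩
    refine ⟨‖a‖ * C, fun t => ?_⟩
    have e : ⟪x, (D.T ^ t) (a • y)⟫_ℂ - ⟪x, D.vacuum⟫_ℂ * ⟪D.vacuum, a • y⟫_ℂ =
        a * (⟪x, (D.T ^ t) y⟫_ℂ - ⟪x, D.vacuum⟫_ℂ * ⟪D.vacuum, y⟫_ℂ) := by
      rw [map_smul, inner_smul_right, inner_smul_right]; ring
    rw [e, norm_mul, mul_assoc]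
    exact mul_le_mul_of_nonneg_left (hC t) (norm_nonneg a)

omit [IsTopologicalGroup G] [CompactSpace G] [BorelSpace G] in
/-- The OS map sends the span of the continuous positive-time species into the span of their OS images. [folklore] -/
theorem osMap_mem_span_contPosTimeObs {μ : Measure (LGConfig 4 G)} [IsProbabilityMeasure μ]
    (h : IsOSReconstructible μ gaugeTimeReflect gaugeTimeShift (posTimeEvents G)) {F : LGConfig 4 G → ℂ}
    (hF : F ∈ Submodule.span ℂ (contPosTimeObs G)) :
    h.osMap F ∈ Submodule.span ℂ (h.osMap '' contPosTimeObs G) := by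
  have hle : Submodule.span ℂ (contPosTimeObs G) ≤ Literature.Probability.LatticeModels.boundedMeasurable (posTimeEvents G) :=
    Submodule.span_le.2 fun F hF => isBoundedMeasurable_posTimeEvents_of_mem hF
  have hzero : h.osMap 0 = 0 := by
    rw [h.osMap_eq (Literature.Probability.LatticeModels.boundedMeasurable (posTimeEvents G)).zero_mem]
    exact map_zero h.vec
  have hadd : ∀ {F₁ F₂ : LGConfig 4 G → ℂ}, IsBoundedMeasurable (posTimeEvents G) F₁ →
      IsBoundedMeasurable (posTimeEvents G) F₂ → h.osMap (F₁ + F₂) = h.osMap F₁ + h.osMap F₂ := by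
    intro F₁ F₂ h₁ h₂
    rw [h.osMap_eq h₁, h.osMap_eq h₂,
      h.osMap_eq ((Literature.Probability.LatticeModels.boundedMeasurable (posTimeEvents G)).add_mem h₁ h₂), ← map_add]
    rfl
  have hsmul : ∀ (a : ℂ) {F₁ : LGConfig 4 G → ℂ}, IsBoundedMeasurable (posTimeEvents G) F₁ →
      h.osMap (a • F₁) = a • h.osMap F₁ := by
    intro a F₁ h₁
    rw [h.osMap_eq h₁, h.osMap_eq ((Literature.Probability.LatticeModels.boundedMeasurable (posTimeEvents G)).smul_mem a h₁),
      ← map_smul]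
    rfl
  induction hF using Submodule.span_induction with
  | mem F hF => exact Submodule.subset_span ⟨F, hF, rfl⟩
  | zero => rw [hzero]; exact zero_mem _
  | add F₁ F₂ hF₁ hF₂ ih₁ ih₂ => rw [hadd (hle hF₁) (hle hF₂)]; exact add_mem ih₁ ih₂
  | smul a F₁ hF₁ ih => rw [hsmul a (hle hF₁)]; exact Submodule.smul_mem _ a ih

variable [SecondCountableTopology G]

/-- ★ **LOCAL CLUSTERING OF AN ODD-TORUS LIMIT STATE ⇒ SPECTRAL GAP OF ITS TRANSFER MATRIX.**  Let `G` be a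
compact second-countable group, `r` a lattice representation, `β ≥ 0`, and `μ` an odd-torus limit state of the
Wilson theory (`oddTorusLimitPoints r β`).  If every pair of bounded measurable local real observables clusters
under `μ` as `|cov_μ(F₁, F₂ ∘ θ_x)| ≤ C(F₁,F₂) e^{-m‖x‖_∞}` with one rate `m > 0`, then `μ` is
Osterwalder–Schrader reconstructible for `(gaugeTimeReflect, gaugeTimeShift, posTimeEvents G)` and the
reconstructed transfer operator has the spectral gap `‖T|_{Ω^⊥}‖ ≤ e^{-m}` (Glimm–Jaffe 1987 Thm. 6.1.3 (iii),
§19.7; Osterwalder–Seiler 1978 §2). [folklore] -/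
theorem hasMassGap_of_localClustering (r : LatticeRep G) {β m : ℝ} (hβ : 0 ≤ β) (hm : 0 < m)
    (μ : Measure (LGConfig 4 G)) [IsProbabilityMeasure μ] (hμ : μ ∈ oddTorusLimitPoints r β)
    (hcl : ∀ F₁ F₂ : LGConfig 4 G → ℝ, Literature.MathematicalPhysics.QuantumLattice.IsLocalObservable F₁ →
      Literature.MathematicalPhysics.QuantumLattice.IsLocalObservable F₂ → Measurable F₁ → Measurable F₂ →
      (∃ C, ∀ U, |F₁ U| ≤ C) → (∃ C, ∀ U, |F₂ U| ≤ C) →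
        ∃ C : ℝ, ∀ x : Literature.Probability.LatticeModels.Site 4,
          |cov[F₁, fun U => F₂ (configShift x U); μ]| ≤ C * Real.exp (-m * ‖x‖)) :
    ∃ h : IsOSReconstructible μ gaugeTimeReflect gaugeTimeShift (posTimeEvents G), h.transferData.HasMassGap m := by
  have hAP : CylinderApprox μ := cylinderApprox_of_secondCountable G μ
  have hExt : CylinderExt G := cylinderExt_of_secondCountable G
  have h : IsOSReconstructible μ gaugeTimeReflect gaugeTimeShift (posTimeEvents G) :=
    AdmissibleGap.isOSReconstructible_of_oddTorusLimit r hβ μ hμ hAP hExt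
  refine ⟨h, hm, gapNorm_le_exp_of_dense_clustering h.transferData m
    (AdmissibleGap.dense_osMap_span r hμ hAP hExt h) ?_⟩
  rintro _ ⟨F, hF, rfl⟩
  have hv := osMap_mem_span_contPosTimeObs h hF
  refine clustering_span_of_pairs h.transferData m ?_ hv hv
  rintro _ ⟨A, hA, rfl⟩ _ ⟨B, hB, rfl⟩
  exact clustering_osMatrix_of_local hcl h hA hB

/-- ★ **`HasInfiniteVolumeGap` from local clustering of all odd-torus limit states.** [folklore] -/
theorem hasInfiniteVolumeGap_of_localClustering (r : LatticeRep G) {β m : ℝ} (hβ : 0 ≤ β) (hm : 0 < m)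
    (hcl : ∀ (μ : Measure (LGConfig 4 G)) [IsProbabilityMeasure μ], μ ∈ oddTorusLimitPoints r β →
      ∀ F₁ F₂ : LGConfig 4 G → ℝ, Literature.MathematicalPhysics.QuantumLattice.IsLocalObservable F₁ →
      Literature.MathematicalPhysics.QuantumLattice.IsLocalObservable F₂ → Measurable F₁ → Measurable F₂ →
      (∃ C, ∀ U, |F₁ U| ≤ C) → (∃ C, ∀ U, |F₂ U| ≤ C) →
        ∃ C : ℝ, ∀ x : Literature.Probability.LatticeModels.Site 4,
          |cov[F₁, fun U => F₂ (configShift x U); μ]| ≤ C * Real.exp (-m * ‖x‖)) :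
    HasInfiniteVolumeGap r β m :=
  fun μ _ hμ => hasMassGap_of_localClustering r hβ hm μ hμ (hcl μ hμ)

end Clustering

/-! ### `SU(N)`: the spectral gap from the cell's `MassGapAt` -/

section SUN

variable {N : ℕ}

/-- Odd-torus limit states are infinite-volume limit points. [folklore] -/
theorem oddTorusLimitPoints_subset_infiniteVolumeLimitPoints {G : Type} [Group G] [TopologicalSpace G]
    [IsTopologicalGroup G] [CompactSpace G] [MeasurableSpace G] [BorelSpace G] (r : LatticeRep G) (β : ℝ) :
    oddTorusLimitPoints r β ⊆ infiniteVolumeLimitPoints (d := 4) r.ρ β := by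
  rintro μ ⟨S, hS, hlim⟩
  exact ⟨fun k => 2 * S k, fun a b hab => by have := hS hab; dsimp; omega, hlim⟩

/-- The infinite-volume limit of the full torus sequence is an odd-torus limit state (sizes `2k + 1`). [folklore] -/
theorem mem_oddTorusLimitPoints_of_isInfiniteVolumeLimit {G : Type} [Group G] [TopologicalSpace G]
    [IsTopologicalGroup G] [CompactSpace G] [MeasurableSpace G] [BorelSpace G] (r : LatticeRep G) {β : ℝ}
    {μ : Measure (LGConfig 4 G)} (h : Literature.MathematicalPhysics.QuantumLattice.IsInfiniteVolumeLimit (d := 4) r.ρ β μ) : μ ∈ oddTorusLimitPoints r β := by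
  refine ⟨id, strictMono_id, h.1, fun F S hFS hFc hFb => ?_⟩
  have key := h.2 F S hFS hFc hFb
  have hφ : Tendsto (fun k : ℕ => 2 * k) atTop atTop :=
    tendsto_id.const_mul_atTop' (by norm_num)
  exact key.comp hφ

/-- **Non-vacuity**: under `MassGapAt 4 N β` the odd-torus limit states are exactly the unique DLR state (which
is the limit of the full torus sequence). [folklore] -/
theorem oddTorusLimitPoints_eq_singleton_of_massGapAt {β : ℝ} (h : MassGapAt 4 N β) :
    ∃ μ : Measure (LGConfig 4 (Matrix.specialUnitaryGroup (Fin N) ℂ)),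
      Literature.MathematicalPhysics.QuantumLattice.IsInfiniteVolumeLimit (d := 4) (fundamentalRep (Fin N)) ((N : ℝ) * β) μ ∧
        ymGibbsMeasures (d := 4) (fundamentalRep (Fin N)) ((N : ℝ) * β) = {μ} ∧
          oddTorusLimitPoints (fundamentalLatticeRep N) ((N : ℝ) * β) = {μ} := by
  haveI : SecondCountableTopology (Matrix (Fin N) (Fin N) ℂ) :=
    inferInstanceAs (SecondCountableTopology (Fin N → Fin N → ℂ))
  haveI : SecondCountableTopology (Matrix.specialUnitaryGroup (Fin N) ℂ) :=
    Topology.IsEmbedding.subtypeVal.secondCountableTopology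
  have hρc := continuous_fundamentalRep (Fin N)
  have hDLR : ∀ ν : Measure (LGConfig 4 (Matrix.specialUnitaryGroup (Fin N) ℂ)),
      ν ∈ oddTorusLimitPoints (fundamentalLatticeRep N) ((N : ℝ) * β) →
        ν ∈ ymGibbsMeasures (d := 4) (fundamentalRep (Fin N)) ((N : ℝ) * β) := by
    intro ν hν
    have hνlim : ν ∈ infiniteVolumeLimitPoints (d := 4) (fundamentalRep (Fin N)) ((N : ℝ) * β) :=
      oddTorusLimitPoints_subset_infiniteVolumeLimitPoints (fundamentalLatticeRep N) ((N : ℝ) * β) hν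
    exact mem_ymGibbsMeasures_of_mem_infiniteVolumeLimitPoints_holds (fundamentalRep (Fin N)) hρc hνlim
  have huniq : ∀ ν ν' : Measure (LGConfig 4 (Matrix.specialUnitaryGroup (Fin N) ℂ)),
      ν ∈ ymGibbsMeasures (d := 4) (fundamentalRep (Fin N)) ((N : ℝ) * β) →
        ν' ∈ ymGibbsMeasures (d := 4) (fundamentalRep (Fin N)) ((N : ℝ) * β) → ν = ν' :=
    fun ν ν' hν hν' => h.1.1 hν hν'
  have hsub : (ymGibbsMeasures (d := 4) (fundamentalRep (Fin N)) ((N : ℝ) * β)).Subsingleton :=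
    fun ν hν ν' hν' => huniq ν ν' hν hν'
  obtain ⟨μ, hlim, -⟩ := hasUniqueInfiniteVolumeLimit_of_subsingleton (d := 4) (fundamentalRep (Fin N)) hρc
    ((N : ℝ) * β) hsub
  have hμodd : μ ∈ oddTorusLimitPoints (fundamentalLatticeRep N) ((N : ℝ) * β) :=
    mem_oddTorusLimitPoints_of_isInfiniteVolumeLimit (fundamentalLatticeRep N) hlim
  have hμG := hDLR μ hμodd
  exact ⟨μ, hlim, Set.eq_singleton_iff_unique_mem.2 ⟨hμG, fun ν hν => huniq ν μ hν hμG⟩,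
    Set.eq_singleton_iff_unique_mem.2 ⟨hμodd, fun ν hν => huniq ν μ (hDLR ν hν) hμG⟩⟩

/-- ★★ **EVERY `SU(N)`, `N ≥ 1`: `MassGapAt 4 N β` AT 't HOOFT COUPLING `β ≥ 0` ⇒ AN INFINITE-VOLUME TRANSFER GAP.**
The cell's Euclidean mass gap (DLR uniqueness + Shen–Zhu–Zhu clustering of Lipschitz cylinder functions, rate
`c > 0`) yields `HasInfiniteVolumeGap (fundamentalLatticeRep N) (N β) c`: every odd-torus limit state — there is
exactly one, the DLR state — is Osterwalder–Schrader reconstructible and its transfer matrix `T = e^{-H}` on the OS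
Hilbert space satisfies `‖T|_{Ω^⊥}‖ ≤ e^{-c}`, i.e. `spec H ⊆ {0} ∪ [c, ∞)` with `0` a simple eigenvalue.  The
rate is the existential clustering rate of `MassGapAt` (a strong-coupling lattice quantity). [folklore] -/
theorem exists_hasInfiniteVolumeGap_of_massGapAt (hN : 1 ≤ N) {β : ℝ} (hβ : 0 ≤ β) (h : MassGapAt 4 N β) :
    ∃ m : ℝ, 0 < m ∧ HasInfiniteVolumeGap (fundamentalLatticeRep N) ((N : ℝ) * β) m := by
  haveI : SecondCountableTopology (Matrix (Fin N) (Fin N) ℂ) :=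
    inferInstanceAs (SecondCountableTopology (Fin N → Fin N → ℂ))
  haveI : SecondCountableTopology (Matrix.specialUnitaryGroup (Fin N) ℂ) :=
    Topology.IsEmbedding.subtypeVal.secondCountableTopology
  have hNβ : 0 ≤ (N : ℝ) * β := by positivity
  obtain ⟨μ₀, -, hG, hodd⟩ := oddTorusLimitPoints_eq_singleton_of_massGapAt h
  have hμ₀G : μ₀ ∈ ymGibbsMeasures (d := 4) (fundamentalRep (Fin N)) ((N : ℝ) * β) := by
    rw [hG]; exact Set.mem_singleton μ₀
  obtain ⟨c, hc, hcl⟩ := h.2 μ₀ hμ₀G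
  refine ⟨c, hc, hasInfiniteVolumeGap_of_localClustering (fundamentalLatticeRep N) hNβ hc ?_⟩
  intro ν _ hν F₁ F₂ h₁ h₂ h₁m h₂m hb₁ hb₂
  rw [hodd] at hν
  have heq : ν = μ₀ := hν
  subst heq
  exact MassGapMassive.covariance_decay_of_lipschitzClustering (d := 4) (by norm_num) hN ((N : ℝ) * β) hμ₀G hc hcl
    F₁ F₂ h₁ h₂ h₁m h₂m hb₁ hb₂

/-- ★★★ **`SU(2)`, `d = 4`, HYPOTHESIS-FREE: THE INFINITE-VOLUME STRONG-COUPLING THEORY HAS A TRANSFER-MATRIX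
(SPECTRAL) MASS GAP at every `0 < β_W ≤ 9/25`** (tree coupling `β_W/2`).  The unique infinite-volume DLR state
`μ` (= the limit of the torus Wilson states, in particular of the odd tori) is Osterwalder–Schrader reconstructible
for the bond time reflection, the unit time shift and the positive-time σ-algebra, and its transfer matrix
`T = e^{-H}` has `‖T|_{Ω^⊥}‖ ≤ e^{-m}` for some `m > 0`: the Hamiltonian `H ≥ 0` of the infinite lattice has
the simple eigenvalue `0` (vacuum) and `spec H ∖ {0} ⊆ [m, ∞)`.  Input: the cell's `MassGapAt 4 2 (β_W/4)`
(`su2_oneState_massive_confining`).  The rate `m` is a strong-coupling lattice quantity; nothing is claimed about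
its behaviour as `β_W` grows or about any continuum limit. [folklore] -/
theorem su2_exists_hasInfiniteVolumeGap {βW : ℝ} (hβ : 0 < βW) (hle : βW ≤ 9 / 25) :
    ∃ m : ℝ, 0 < m ∧ HasInfiniteVolumeGap (fundamentalLatticeRep 2) (βW / 2) m ∧
      ∃ μ : Measure (LGConfig 4 (Matrix.specialUnitaryGroup (Fin 2) ℂ)),
        Literature.MathematicalPhysics.QuantumLattice.IsInfiniteVolumeLimit (d := 4) (fundamentalRep (Fin 2)) (βW / 2) μ ∧
          ymGibbsMeasures (d := 4) (fundamentalRep (Fin 2)) (βW / 2) = {μ} ∧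
            oddTorusLimitPoints (fundamentalLatticeRep 2) (βW / 2) = {μ} := by
  obtain ⟨-, -, -, -, hgap, -⟩ := WilsonStringTension.su2_oneState_massive_confining hβ hle
  have e : (((2 : ℕ) : ℝ)) * (βW / 4) = βW / 2 := by push_cast; ring
  obtain ⟨m, hm, hIV⟩ := exists_hasInfiniteVolumeGap_of_massGapAt (N := 2) (by norm_num) (by linarith) hgap
  obtain ⟨μ, hlim, hG, hodd⟩ := oddTorusLimitPoints_eq_singleton_of_massGapAt (N := 2) hgap
  rw [e] at hIV hlim hG hodd
  exact ⟨m, hm, hIV, μ, hlim, hG, hodd⟩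

/-- ★★ **THE EUCLIDEAN READING FOR ALL BOUNDED POSITIVE-TIME OBSERVABLES** (`SU(N)`, `MassGapAt 4 N β`, `β ≥ 0`):
for every odd-torus limit state `μ` there are a Hilbert space, an OS map `ι` and transfer data `(T, Ω)` realising `μ`,
and for ALL bounded `𝓔₊`-measurable `F, G` — local or not —
`|∫ conj(F∘Θ) · G∘τᵗ dμ − (∫ conj(F∘Θ) dμ)(∫ G dμ)| ≤ C_{F,G} e^{-mt}` (`HasTimeClustering`, Glimm–Jaffe 6.1.3:
the gap gives clustering with `C = ‖ι F‖ ‖ι G‖`). [folklore] -/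
theorem hasTimeClustering_of_massGapAt (hN : 1 ≤ N) {β : ℝ} (hβ : 0 ≤ β) (h : MassGapAt 4 N β) :
    ∃ m : ℝ, 0 < m ∧ ∀ (μ : Measure (LGConfig 4 (Matrix.specialUnitaryGroup (Fin N) ℂ))) [IsProbabilityMeasure μ],
      μ ∈ oddTorusLimitPoints (fundamentalLatticeRep N) ((N : ℝ) * β) →
        Literature.Probability.LatticeModels.HasTimeClustering μ gaugeTimeReflect gaugeTimeShift
          (posTimeEvents (Matrix.specialUnitaryGroup (Fin N) ℂ)) m := by
  obtain ⟨m, hm, hIV⟩ := exists_hasInfiniteVolumeGap_of_massGapAt hN hβ h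
  refine ⟨m, hm, fun μ _ hμ => ?_⟩
  obtain ⟨hrec, hgap⟩ := hIV μ hμ
  exact Literature.Probability.LatticeModels.IsOSRealisation.hasTimeClustering_of_hasMassGap_holds hrec.isOSRealisation
    hgap

end SUN

end Summit.Ventures.YMGap.RobustBall.TransferGap

end
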